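import Literature.NumberTheory.GaloisRepresentations.IdeleClassBarRelativeLayerGalois
import Literature.NumberTheory.GaloisRepresentations.IdeleClassBarInvariantSubgroup
import Literature.Algebra.Homology.DiscreteRepLayerColimitLemmas
import Literature.Algebra.Homology.IntModBockstein
import Literature.Algebra.Homology.UnramifiedClassModule
import HarnessLib

/-!
# Milne's (b) for `(U, Res_U C̄)`: the layer pairing values ARE the cup products `inv_{E/L}(x_E ∪ β_m χ)` of the base
# field `L = F̄^U` (Milne ADT I Lemma 1.7; Tate C–F VII §11.3)

Topic `NumberTheory/GaloisRepresentations`; namespace `Literature.NumberTheory.GaloisRepresentations.IdeleClassBar`.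
Sequel to door-c4 g16's `DiscreteRepModPairingLayers.lean` (generic: the class paired by `α¹(Δ, ℤ/m)` is
`Inf_V (H²(id, homToLayer φ) (β_m χ))`, `layerPairingValue`), `IdeleClassBarInvariantSubgroup.lean` (`classBarInvAt = inv_U`,
`classBarInvAt_inflG`), `IdeleClassBarRelativeInvariant.lean` (`relLayerInv_apply`), `IdeleClassBarRelativeLayerGalois.lean`
(`galEquivSubgroupImage : Gal(E/L) ≃* H_E`, `T = subgroupImageToGalCohomology`, `invSub_apply_eq_classInvAll`) and door-c6's
`IntModBockstein.lean` (`Bockstein.map_δ_intMod`: the Bockstein commutes with change of group).  Definitions with bodies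
(`galToTraceQuot`, `layerVector`) and theorems; NO named fact, no `sorry`, no instance, no notation.

THE POINT.  For `U = Gal(F̄/L)` (`L` a layer), a layer `E ⊇ L`, an invariant vector `φ : ℤ → Res_U C̄` of `C_U` (an element of
`C̄^U = C_L`) and a character `χ ∈ H¹(U ⧸ (U_E ∩ U), ℤ/m)` of the trace layer, the value of Milne's pairing
(`layerPairingValue`, door-c4 g16) for `inv_U = classBarInvAt` is

  **`inv_U (Inf (H²(id, φ_V) (β_m χ))) = inv_{E/L} (H²(id, r ↦ r • x_E) (β_m (χ ∘ g)))`** (`layerPairingValue_eq_classInvAll`),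

where `x_E ∈ C_E` is the vector of `φ` read in the layer `E` (`layerVector`), `g : Gal(E/L) ≃ U ⧸ (U_E ∩ U)`
(`galToTraceQuot`, from door-c6's `subgroupImageEquiv` and door-c4's `galEquivSubgroupImage`), and the right-hand side is
door-c6 g13/g14's cup product `x_E ∪ β_m[χ ∘ g] ∈ H²(Gal(E/L), C_E)` evaluated by THE invariant map `inv_{E/L} = classInvAll L E`
— whose value `−χ(ψ_{E/L} x)/m` is door-c6's `classInvAll_baseCup_bockstein_*` (the sequel closes the field
`adjointBijective_one_zmod` with door-c6 g11/g14's kernel/surjectivity of the Artin map modulo `m`).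

HONEST FRAMING: bookkeeping between door-c4's `Ext`/layer currency and door-c6's finite-layer cup products; no case of BSD or
of Poitou–Tate is proved.  Route A (A5)-ARITH of crux `AnticycControlAdditiveK` (item 19295, cell bsd-schneider), seat door-c4
gen 16.

## References
* J. S. Milne, *Arithmetic Duality Theorems* (2nd ed. 2006), I §1 Lemma 1.7, Theorem 1.8 (b). [MilneADT2006]
* J. W. S. Cassels, A. Fröhlich (eds.), *Algebraic Number Theory* (1967), Ch. VII (J. Tate) §11.3. [CasselsFrohlichANT1967]
* J.-P. Serre, *Local Fields*, GTM 67 (1979), XIV §1 (`ā · δχ`). [Serre1979]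
-/

noncomputable section

open NumberField CategoryTheory groupCohomology
open Field (absoluteGaloisGroup)
open Literature.NumberTheory.Automorphic Literature.NumberTheory.Automorphic.IdeleClassGroup
open Literature.NumberTheory.NumberFields
open Literature.Algebra.Homology Literature.Algebra.Homology.DiscreteRep
open scoped Classical

namespace Literature.NumberTheory.GaloisRepresentations

namespace IdeleClassBar

variable {F : Type} [Field F] [NumberField F] {L E : GalLayer F}

/-! ## §23. `Gal(E/L) → U_L ⧸ (U_E ∩ U_L)` and the vector of `φ` in the layer `E` -/

/-- **`g : Gal(E/L) →* U_L ⧸ (U_E ∩ U_L)`**: `galEquivSubgroupImage` followed by the inverse of door-c6's `subgroupImageEquiv`.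
[cite: Serre1979, XI §1 (iv)] -/
def galToTraceQuot (h : L ≤ E) :
    (letI := GalLayer.algebraOfLE h; (E.1 ≃ₐ[L.1] E.1)) →*
      (L.openNormalSubgroup : Subgroup (absoluteGaloisGroup F)) ⧸
        (traceOpenNormalSubgroup (L.openNormalSubgroup : Subgroup (absoluteGaloisGroup F)) E.openNormalSubgroup :
          Subgroup (L.openNormalSubgroup : Subgroup (absoluteGaloisGroup F))) :=
  (GalLayer.subgroupImageEquiv (L.openNormalSubgroup : Subgroup (absoluteGaloisGroup F)) E).symm.toMonoidHom.comp
    (galEquivSubgroupImage h).toMonoidHom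

/-- **The vector `x_E ∈ C_E` of `φ : ℤ → Res_U C̄` read in the layer `E`** (`relLayerEquiv` of the value at `1` of the layer
morphism `homToLayer φ`). [cite: CasselsFrohlichANT1967, Ch. VII §11.3] -/
def layerVector (h : L ≤ E) (φ : triv (k := ℤ) (Γ := (L.openNormalSubgroup : Subgroup (absoluteGaloisGroup F))) ℤ ⟶
    (resD ℤ (L.openNormalSubgroup : Subgroup (absoluteGaloisGroup F))).obj (classData F).toSystem.toD) :
    ((classData F).obj E).V :=
  (classData F).relLayerEquiv (U := (L.openNormalSubgroup : Subgroup (absoluteGaloisGroup F)))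
    (GalLayer.coe_openNormalSubgroup_le h)
    ((LayerColimit.homToLayer (traceOpenNormalSubgroup (L.openNormalSubgroup : Subgroup (absoluteGaloisGroup F))
      E.openNormalSubgroup : Subgroup _) _ φ).hom 1)

/-- The value at `1` of `homToLayer φ` is invariant under the layer group (it comes from the trivial representation).
[cite: SerreGaloisCohomology1997, I §2.2 Proposition 8] -/
theorem homToLayer_one_invariant
    (φ : triv (k := ℤ) (Γ := (L.openNormalSubgroup : Subgroup (absoluteGaloisGroup F))) ℤ ⟶
      (resD ℤ (L.openNormalSubgroup : Subgroup (absoluteGaloisGroup F))).obj (classData F).toSystem.toD)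
    (q : (L.openNormalSubgroup : Subgroup (absoluteGaloisGroup F)) ⧸
        (traceOpenNormalSubgroup (L.openNormalSubgroup : Subgroup (absoluteGaloisGroup F)) E.openNormalSubgroup :
          Subgroup (L.openNormalSubgroup : Subgroup (absoluteGaloisGroup F)))) :
    ((classData F).relLayerRep (L.openNormalSubgroup : Subgroup (absoluteGaloisGroup F)) E).ρ q
        ((LayerColimit.homToLayer (traceOpenNormalSubgroup (L.openNormalSubgroup : Subgroup (absoluteGaloisGroup F))
          E.openNormalSubgroup : Subgroup _) _ φ).hom 1) =
      (LayerColimit.homToLayer (traceOpenNormalSubgroup (L.openNormalSubgroup : Subgroup (absoluteGaloisGroup F))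
        E.openNormalSubgroup : Subgroup _) _ φ).hom 1 := by
  induction q using QuotientGroup.induction_on with
  | H u =>
    apply Subtype.ext
    rw [GalLayerData.coe_relLayerRep_ρ_mk, LayerColimit.homToLayer_hom_apply_coe]
    exact (Rep.hom_comm_apply φ.hom u (1 : ℤ)).symm

/-- **`x_E` is `Gal(E/L)`-invariant** (as a vector of `galoisRep L E`). [cite: CasselsFrohlichANT1967, Ch. VII §11.3] -/
theorem layerVector_invariant (h : L ≤ E)
    (φ : triv (k := ℤ) (Γ := (L.openNormalSubgroup : Subgroup (absoluteGaloisGroup F))) ℤ ⟶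
      (resD ℤ (L.openNormalSubgroup : Subgroup (absoluteGaloisGroup F))).obj (classData F).toSystem.toD)
    (σ : (letI := GalLayer.algebraOfLE h; (E.1 ≃ₐ[L.1] E.1))) :
    (letI := GalLayer.algebraOfLE h; haveI := L.numberField; haveI := E.numberField;
      (IdeleClassGroup.galoisRep L.1 E.1).ρ σ (layerVector h φ)) = layerVector h φ := by
  letI := GalLayer.algebraOfLE h
  haveI := GalLayer.isScalarTower_of_le h
  haveI := L.numberField
  haveI := E.numberField
  -- `σ|^F = u|_E` for some `u ∈ U_L`
  obtain ⟨u, hu⟩ := GalLayer.toSubgroupImage_surjective (L.openNormalSubgroup : Subgroup (absoluteGaloisGroup F)) E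
    (galEquivSubgroupImage h σ)
  have hσ : galResHom h σ = E.restrictHom (u : absoluteGaloisGroup F) := by
    rw [← coe_galEquivSubgroupImage h σ, ← hu, GalLayer.coe_toSubgroupImage_apply]
  have hρ : (IdeleClassGroup.galoisRep L.1 E.1).ρ σ (layerVector h φ) =
      (classData F).ρ E (E.restrictHom (u : absoluteGaloisGroup F)) (layerVector h φ) := by
    rw [← hσ, IdeleClassGroup.galoisRep_ρ_apply, AlgEquiv.restrictScalarsHom_apply,
      ← IdeleClassGroup.classGalAct_restrictScalars (F := F), ← IdeleClassGroup.galoisRep_ρ_apply]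
    rfl
  rw [hρ, layerVector, ← (classData F).relLayerEquiv_ρ_mk (GalLayer.coe_openNormalSubgroup_le h) u,
    homToLayer_one_invariant]

/-! ## §24. The comparison `T ∘ relIso` on the classes `H²(id, homToLayer φ) z` -/

set_option maxHeartbeats 1600000 in
-- three `groupCohomology.map` composites compared through `map_comp` / `map_congr'` against the `ℤ`-instance paths of the
-- relative layer objects (cf. door-c6 `stepG_comp_relLayerCohomologyIso`)
/-- **`T (relIso (H²(id, homToLayer φ) z)) = H²(id, r ↦ r • x_E) (H²(g, 𝟙) z)`** for `z ∈ H²(U_L ⧸ (U_E ∩ U_L), ℤ)`: under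
door-c6's `relLayerCohomologyIso` and door-c4's `subgroupImageToGalCohomology`, pushing a class along the layer morphism
`homToLayer φ` becomes the cup product with the vector `x_E` (door-c6's `smulHom`), after pulling the class back to `Gal(E/L)`.
[cite: CasselsFrohlichANT1967, Ch. VII §11.3][cite: Serre1979, XIV §1] -/
theorem subgroupImageToGalCohomology_relLayerCohomologyIso_map_homToLayer (h : L ≤ E)
    (φ : triv (k := ℤ) (Γ := (L.openNormalSubgroup : Subgroup (absoluteGaloisGroup F))) ℤ ⟶
      (resD ℤ (L.openNormalSubgroup : Subgroup (absoluteGaloisGroup F))).obj (classData F).toSystem.toD)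
    {m : ℕ} (z : groupCohomology (Bockstein.intModShortComplex ((L.openNormalSubgroup : Subgroup (absoluteGaloisGroup F)) ⧸
        (traceOpenNormalSubgroup (L.openNormalSubgroup : Subgroup (absoluteGaloisGroup F)) E.openNormalSubgroup :
          Subgroup (L.openNormalSubgroup : Subgroup (absoluteGaloisGroup F)))) m).X₁ 2) :
    subgroupImageToGalCohomology h 2
        (((classData F).relLayerCohomologyIso (U := (L.openNormalSubgroup : Subgroup (absoluteGaloisGroup F)))
            (GalLayer.coe_openNormalSubgroup_le h) 2).hom
          (groupCohomology.map (MonoidHom.id _)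
            (LayerColimit.homToLayer (traceOpenNormalSubgroup (L.openNormalSubgroup : Subgroup (absoluteGaloisGroup F))
              E.openNormalSubgroup : Subgroup _) _ φ) 2 z)) =
      groupCohomology.map (MonoidHom.id _)
        (letI := GalLayer.algebraOfLE h; haveI := L.numberField; haveI := E.numberField;
          Unramified.smulHom (IdeleClassGroup.galoisRep L.1 E.1) (layerVector h φ) (layerVector_invariant h φ)) 2
        (groupCohomology.map (galToTraceQuot h) (𝟙 (Rep.trivial ℤ _ ℤ)) 2 z) := by
  letI := GalLayer.algebraOfLE h
  haveI := GalLayer.isScalarTower_of_le h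
  haveI := L.numberField
  haveI := E.numberField
  rw [← ModuleCat.comp_apply, ← ModuleCat.comp_apply, ← ModuleCat.comp_apply, subgroupImageToGalCohomology,
    GalLayerData.relLayerCohomologyIso, groupCohomology.mapIso_hom, ← groupCohomology.map_comp,
    ← groupCohomology.map_comp, ← groupCohomology.map_comp]
  refine DFunLike.congr_fun (congrArg ModuleCat.Hom.hom ?_) z
  refine map_congr' (MonoidHom.ext fun _ => rfl) _ _ (fun r => ?_) 2
  -- both sides are `ℤ`-linear in `r ∈ ℤ`: compare them at `r = 1`
  rw [← Representation.IntertwiningMap.toLinearMap_apply, ← Representation.IntertwiningMap.toLinearMap_apply]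
  refine LinearMap.congr_fun (LinearMap.ext_ring (R := ℤ) (S := ℤ) (σ := RingHom.id ℤ) ?_) r
  change layerVector h φ = (Unramified.smulHom (IdeleClassGroup.galoisRep L.1 E.1) (layerVector h φ)
    (layerVector_invariant h φ)).hom (1 : ℤ)
  rw [Unramified.smulHom_apply]
  exact (one_smul ℤ _).symm

omit [NumberField F] in
/-- **The Bockstein commutes with `g`**: `H²(g, 𝟙) (β_m χ) = β_m (H¹(g, 𝟙) χ)` (door-c6 `Bockstein.map_δ_intMod`).
[cite: CasselsFrohlichANT1967, Ch. IV §6–7] -/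
theorem map_galToTraceQuot_bockstein (h : L ≤ E) {m : ℕ} (hm : 0 < m)
    (χ : groupCohomology (Rep.trivial ℤ ((L.openNormalSubgroup : Subgroup (absoluteGaloisGroup F)) ⧸
        (traceOpenNormalSubgroup (L.openNormalSubgroup : Subgroup (absoluteGaloisGroup F)) E.openNormalSubgroup :
          Subgroup (L.openNormalSubgroup : Subgroup (absoluteGaloisGroup F)))) (ZMod m)) 1) :
    haveI : NeZero m := ⟨hm.ne'⟩
    groupCohomology.map (galToTraceQuot h) (𝟙 (Rep.trivial ℤ _ ℤ)) 2
        (groupCohomology.δ (Bockstein.intModShortComplex_shortExact _ m) 1 2 rfl χ) =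
      groupCohomology.δ (Bockstein.intModShortComplex_shortExact _ m) 1 2 rfl
        (groupCohomology.map (galToTraceQuot h) (𝟙 (Rep.trivial ℤ _ (ZMod m))) 1 χ) :=
  haveI : NeZero m := ⟨hm.ne'⟩
  Bockstein.map_δ_intMod m (galToTraceQuot h) χ

/-! ## §25. The layer pairing values of `(U_L, Res C̄)` are the cup products of the base field `L` -/

variable [CompactSpace (absoluteGaloisGroup F)] [TotallyDisconnectedSpace (absoluteGaloisGroup F)]

set_option maxHeartbeats 1600000 in
-- the rewrite with §24's comparison unifies the large layer / cohomology terms produced by unfolding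
-- `layerPairingValue` (door-c4 g16) against their directly elaborated forms
/-- **`inv_U (Inf (H²(id, φ_V) (β_m χ))) = inv_{E/L} (x_E ∪ β_m (χ ∘ g))`**: the value of Milne's pairing for `inv_U = classBarInvAt`
at the trace layer of `E ⊇ L` (door-c4 g16 `DiscreteRep.layerPairingValue`, written out: the left-hand side IS
`layerPairingValue (Res_U C̄) (classBarInvAt F U_L _) hm (U_E ∩ U_L) φ χ` by `rfl`) is THE invariant map of `L` on door-c6's cup product
`H²(id, r ↦ r • x_E) (β_m (χ ∘ g)) ∈ H²(Gal(E/L), C_E)`.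
[cite: MilneADT2006, I Lemma 1.7][cite: CasselsFrohlichANT1967, Ch. VII §11.3] -/
theorem layerPairingValue_eq_classInvAll (h : L ≤ E) {m : ℕ} (hm : 0 < m)
    (φ : triv (k := ℤ) (Γ := (L.openNormalSubgroup : Subgroup (absoluteGaloisGroup F))) ℤ ⟶
      (resD ℤ (L.openNormalSubgroup : Subgroup (absoluteGaloisGroup F))).obj (classData F).toSystem.toD)
    (χ : groupCohomology (Rep.trivial ℤ ((L.openNormalSubgroup : Subgroup (absoluteGaloisGroup F)) ⧸
        (traceOpenNormalSubgroup (L.openNormalSubgroup : Subgroup (absoluteGaloisGroup F)) E.openNormalSubgroup :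
          Subgroup (L.openNormalSubgroup : Subgroup (absoluteGaloisGroup F)))) (ZMod m)) 1) :
    haveI : NeZero m := ⟨hm.ne'⟩
    classBarInvAt F (L.openNormalSubgroup : Subgroup (absoluteGaloisGroup F)) (LayerColimit.coe_isOpen _)
        (LayerColimit.inflG
          (traceOpenNormalSubgroup (L.openNormalSubgroup : Subgroup (absoluteGaloisGroup F)) E.openNormalSubgroup)
          ((resD ℤ (L.openNormalSubgroup : Subgroup (absoluteGaloisGroup F))).obj (classData F).toSystem.toD) 2
          (groupCohomology.map (MonoidHom.id _)
            (LayerColimit.homToLayer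
              (traceOpenNormalSubgroup (L.openNormalSubgroup : Subgroup (absoluteGaloisGroup F)) E.openNormalSubgroup :
                Subgroup (L.openNormalSubgroup : Subgroup (absoluteGaloisGroup F)))
              ((resD ℤ (L.openNormalSubgroup : Subgroup (absoluteGaloisGroup F))).obj (classData F).toSystem.toD) φ) 2
            (groupCohomology.δ (Bockstein.intModShortComplex_shortExact
              ((L.openNormalSubgroup : Subgroup (absoluteGaloisGroup F)) ⧸
                (traceOpenNormalSubgroup (L.openNormalSubgroup : Subgroup (absoluteGaloisGroup F)) E.openNormalSubgroup :
                  Subgroup (L.openNormalSubgroup : Subgroup (absoluteGaloisGroup F)))) m) 1 2 rfl χ))) =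
      (letI := GalLayer.algebraOfLE h; haveI := GalLayer.isScalarTower_of_le h; haveI := L.numberField;
        haveI := E.numberField; haveI := E.isGalois; haveI : IsGalois L.1 E.1 := IsGalois.tower_top_of_isGalois F L.1 E.1;
        IdeleCohomology.classInvAll L.1 E.1
          (groupCohomology.map (MonoidHom.id _)
            (Unramified.smulHom (IdeleClassGroup.galoisRep L.1 E.1) (layerVector h φ) (layerVector_invariant h φ)) 2
            (groupCohomology.δ (Bockstein.intModShortComplex_shortExact _ m) 1 2 rfl
              (groupCohomology.map (galToTraceQuot h) (𝟙 (Rep.trivial ℤ _ (ZMod m))) 1 χ)))) := by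
  haveI : NeZero m := ⟨hm.ne'⟩
  rw [classBarInvAt_inflG F _ _ (GalLayer.coe_openNormalSubgroup_le h), relLayerInv_apply,
    invSub_apply_eq_classInvAll h, subgroupImageToGalCohomology_relLayerCohomologyIso_map_homToLayer h,
    map_galToTraceQuot_bockstein h hm]
  rfl

end IdeleClassBar

end Literature.NumberTheory.GaloisRepresentations

end
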